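import Mathlib
import HarnessLib
import Summits.Ventures.LatticeQCDFlow.Exactness.NCMCGeneralSpaceEventTauIntPositive
import Summits.Ventures.LatticeQCDFlow.Exactness.NCMCGeneralSpaceGammaMethodStudentizedCLT
import Summits.Ventures.LatticeQCDFlow.Exactness.NCMCGeneralSpaceRestartChainEveryStart

/-!
# The asymptotic variance of a record observable along the restart chain is at least its mean CONDITIONAL variance given the launch configuration: `σ²_g ≥ ∫ Var_{κF(x,·)}(g) dν̄₀` — so the Jarzynski lane's `σ²_w > 0` whenever the work is not determined by the launch point

HONEST FRAMING: exact (Metropolis-corrected) sampling algorithms for lattice gauge theory;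
figures of merit are autocorrelation/cost numbers at stated couplings and volumes; no
continuum-physics claim.

Venture `LatticeQCDFlow` (cell pub-lqcd), topic `Exactness`; FANOUT row 13 (`eng-snf`, GEN-22).
NEW WORK of the cell, not a published result; no definition is introduced; nothing is cited as a
fact (the "law of total variance" is NAMED ONLY).  The studentized CLT / Γ-method coverage of the
Jarzynski estimate along correlated starts (`NCMCGeneralSpaceRestartChainGammaCoverage.lean`)
ASSUMES that the Green–Kubo variance `σ²_w` of the weights along the restart chain
`R = (κF ∘ₖ K).comap s` is positive; GEN-21 showed that for a GENERAL bounded observable a Doeblin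
power does not force this (`NCMCGeneralSpaceAsymptoticVarianceCounterexample`).  The restart chain
has extra structure — the next record is launched afresh from a `K`-move of the current launch
point — and this file turns it into an explicit floor.  With `h` the bounded Poisson solution
`h − Rh = ḡ` (GEN-19 `poisson_exists_of_nHit`; `R` is minorised in one step, GEN-18) and the
martingale form `σ²_g = ∫ h² dP_F − ∫ (Rh)² dP_F` (GEN-19
`integral_sq_sub_sq_kop_eq_greenKubo_of_nHit`): `Rh = u ∘ s` depends on the record only through its
start, `h = ḡ + u ∘ s`, so conditioning on the launch point `x` (`s = x` a.s. under `κF(x, ·)`,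
`CrooksPair.start_ae`) splits `∫ h² dP_F − ∫ (Rh)² dP_F = ∫ Var_{κF(x,·)}(ḡ) dν̄₀ + (∫ ψ² dν̄₀ −
∫ (Kψ)² dν̄₀)` with `ψ = κF ḡ + u` and `u = Kψ`; the last bracket is non-negative by Jensen and
the `K`-invariance of `ν̄₀` (GEN-21 `sq_sub_sq_kop_nonneg`).

## Content (Crooks pair between finite weights, `Z₀ ≠ 0`; `K` Markov, `ν₀`-invariant, `m ≤ K(z, ·)`
## for all `z`, `m` finite non-zero; `R = (κF ∘ₖ K).comap s`, `P_F = fwdPathLaw ν₀ κF`,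
## `ν̄₀ = Z₀⁻¹ ν₀`; `g` bounded measurable, `ḡ = g − E_F g`)

* `integral_fwdPathLaw_eq_integral_integral` — `∫ F dP_F = ∫ (∫ F dκF(x,·)) dν̄₀` (bounded `F`).
* **`CrooksPair.integral_condVar_le_greenKubo_variance_restartChain`** — THE FLOOR:
  `∫ (∫ (g − ∫ g dκF(x,·))² dκF(x,·)) dν̄₀ ≤ ∫ ḡ² dP_F + 2 Σ_{k≥0} ∫ ḡ · (kop R)^[k+1] ḡ dP_F`.
* **`CrooksPair.greenKubo_variance_restartChain_pos_of_condVar`** — if the mean conditional variance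
  is positive, so is `σ²_g` (stated in row 8's `autocov` form, the hypothesis `hσ` of
  `NCMCGeneralSpaceRestartChainGammaCoverage`); `…_exp_neg_work_…` — the weights `g = e^{−W}`.

Reading (value-free): for a STOCHASTIC protocol (heat-bath / over-relaxation layers between the
coupling steps) the work given the launch configuration has positive variance on a set of launch
points of positive prior weight, and the Γ-method error bar of `dF` along correlated launches is
asymptotically exact with no further hypothesis; for a DETERMINISTIC protocol (a pure flow map)
the floor is `0` and positivity is a property of the level sampler `K` (e.g. reversibility:
GEN-21 `NCMCGeneralSpaceReversibleTauIntFloor`).  NOT CLAIMED: equality; a floor in terms of `K`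
alone; unbounded observables; anything numerical.
-/

namespace Summit.Ventures.LatticeQCDFlow.Exactness.GeneralNCMC

open MeasureTheory ProbabilityTheory Set Filter Finset
open scoped ENNReal Topology

variable {Ω E : Type*} [MeasurableSpace Ω] [MeasurableSpace E]

/-! ## §1 Integration against the equilibrium path law, launch point by launch point -/

/-- **`∫ F dP_F = ∫ (∫ F dκF(x, ·)) dν̄₀`** for bounded measurable `F` (`P_F = κF ∘ₘ ν̄₀`,
`ν̄₀ = Z₀⁻¹ ν₀`). -/
theorem integral_fwdPathLaw_eq_integral_integral (ν₀ : Measure Ω) [IsFiniteMeasure ν₀]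
    (κF : Kernel Ω E) [IsMarkovKernel κF] {F : E → ℝ} (hF : Measurable F) {C : ℝ}
    (hC : ∀ ω, |F ω| ≤ C) :
    ∫ ω, F ω ∂(fwdPathLaw ν₀ κF) = ∫ x, ∫ ω, F ω ∂(κF x) ∂((ν₀ univ)⁻¹ • ν₀) := by
  rw [CrooksPair.fwdPathLaw_eq_bind_smul]
  have hint : Integrable F (κF ∘ₘ ((ν₀ univ)⁻¹ • ν₀)) :=
    Scoring.integrable_of_bounded _ hF hC
  change ∫ ω, F ω ∂(κF ∘ₘ ((ν₀ univ)⁻¹ • ν₀)) = _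
  rw [Measure.comp_eq_comp_const_apply] at hint ⊢
  rw [Kernel.integral_comp hint, Kernel.const_apply]

namespace CrooksPair

variable {ν₀ ν₁ : Measure Ω} [IsFiniteMeasure ν₀] [IsFiniteMeasure ν₁] {κF κR : Kernel Ω E}
  [IsMarkovKernel κF] [IsMarkovKernel κR] {s e : E → Ω} {W : E → ℝ}

omit [IsFiniteMeasure ν₀] [IsFiniteMeasure ν₁] [IsMarkovKernel κF] [IsMarkovKernel κR] in
/-- A record that remembers its start: under `κF(x, ·)`, a function of `(ω, s ω)` is a function of
`(ω, x)`. -/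
theorem integral_start_eq (h : CrooksPair ν₀ ν₁ κF κR s e W) (G : E → Ω → ℝ) (x : Ω) :
    ∫ ω, G ω (s ω) ∂(κF x) = ∫ ω, G ω x ∂(κF x) :=
  integral_congr_ae ((h.start_ae x).mono fun ω hω => by
    show G ω (s ω) = G ω x
    rw [hω])

/-! ## §2 The floor -/

omit [IsFiniteMeasure ν₁] [IsMarkovKernel κR] in
/-- **THE ASYMPTOTIC VARIANCE ALONG THE RESTART CHAIN IS AT LEAST THE MEAN CONDITIONAL VARIANCE GIVEN
THE LAUNCH POINT.**  Crooks pair with `Z₀ ≠ 0`; `K` Markov, `ν₀`-invariant, `m ≤ K(z, ·)` for all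
`z` (`m` finite, `m(Ω) ≠ 0`); `g` measurable with `|g| ≤ C`; `R = (κF ∘ₖ K).comap s`,
`P_F = fwdPathLaw ν₀ κF`, `ḡ = g − ∫ g dP_F`.  Then
`∫ (∫ (g − ∫ g dκF(x,·))² dκF(x,·)) d(Z₀⁻¹ν₀) ≤ ∫ ḡ² dP_F + 2 Σ_{k≥0} ∫ ḡ · (kop R)^[k+1] ḡ dP_F`. -/
theorem integral_condVar_le_greenKubo_variance_restartChain (K : Kernel Ω Ω) [IsMarkovKernel K]
    (h0 : ν₀ univ ≠ 0) (hK : Kernel.Invariant K ν₀) (h : CrooksPair ν₀ ν₁ κF κR s e W)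
    {m : Measure Ω} [IsFiniteMeasure m] (hm0 : m univ ≠ 0) (hmin : ∀ z, m ≤ K z)
    {g : E → ℝ} (hg : Measurable g) {C : ℝ} (hC : ∀ ω, |g ω| ≤ C) :
    ∫ x, ∫ ω, (g ω - ∫ ω', g ω' ∂(κF x)) ^ 2 ∂(κF x) ∂((ν₀ univ)⁻¹ • ν₀)
      ≤ (∫ ω, (g ω - ∫ z, g z ∂(fwdPathLaw ν₀ κF)) ^ 2 ∂(fwdPathLaw ν₀ κF))
        + 2 * ∑' k, ∫ ω, (g ω - ∫ z, g z ∂(fwdPathLaw ν₀ κF))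
          * (Scoring.kop ((κF ∘ₖ K).comap s h.measurable_s))^[k + 1]
              (fun ω => g ω - ∫ z, g z ∂(fwdPathLaw ν₀ κF)) ω ∂(fwdPathLaw ν₀ κF) := by
  -- notation and instances
  set R := (κF ∘ₖ K).comap s h.measurable_s with hR
  set P := fwdPathLaw ν₀ κF with hPdef
  set nb := (ν₀ univ)⁻¹ • ν₀ with hnb
  haveI : IsProbabilityMeasure P := isProbabilityMeasure_fwdPathLaw ν₀ h0 κF
  haveI : IsProbabilityMeasure nb :=
    ⟨by rw [hnb, Measure.smul_apply, smul_eq_mul, ENNReal.inv_mul_cancel h0 (measure_ne_top _ _)]⟩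
  haveI := isProbabilityMeasure_normalised_bind_kernel κF hm0
  haveI : Nonempty E := nonempty_of_isProbabilityMeasure P
  have hπ : Kernel.Invariant R P := h.invariant_restartKernel K hK
  have hKnb : Kernel.Invariant K nb := invariant_smul K hK _
  have hminR := restartKernel_nHit_one_minorised K h hm0 hmin
  have hε1 : m univ ≤ 1 := by
    haveI := isMarkovKernel_nHit R 1
    exact eps_le_one_of_minorised hminR
  have hC0 : 0 ≤ C := (abs_nonneg _).trans (hC (Classical.choice ‹Nonempty E›))
  -- the centred observable
  set θ := ∫ z, g z ∂P with hθ
  have hθb : |θ| ≤ C := by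
    rw [hθ, ← Real.norm_eq_abs]
    calc ‖∫ z, g z ∂P‖ ≤ C * P.real univ :=
          norm_integral_le_of_norm_le_const (Eventually.of_forall fun z => by
            rw [Real.norm_eq_abs]; exact hC z)
      _ = C := by rw [probReal_univ, mul_one]
  set gb : E → ℝ := fun ω => g ω - θ with hgb
  have hgbm : Measurable gb := hg.sub measurable_const
  have hgbb : ∀ ω, |gb ω| ≤ 2 * C := fun ω => by
    rw [hgb]
    calc |g ω - θ| ≤ |g ω| + |θ| := abs_sub _ _
      _ ≤ C + C := add_le_add (hC ω) hθb
      _ = 2 * C := by ring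
  have hgb0 : ∫ ω, gb ω ∂P = 0 := by
    rw [hgb]
    simp only
    rw [integral_sub (Scoring.integrable_of_bounded P hg hC) (integrable_const _), integral_const,
      probReal_univ, one_smul, hθ, sub_self]
  -- the Poisson solution and the martingale form of the variance
  obtain ⟨hh, hhm, hhb, hpois⟩ := poisson_exists_of_nHit (κ := R) (π := P)
    (fun z B hB => minorised_setwise hminR z hB) (pos_iff_ne_zero.2 hm0) hε1 Nat.one_pos hπ hgbm
    hgbb hgb0
  set Hb : ℝ := 2 * (2 * C) * (1 : ℕ) / (m univ).toReal with hHb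
  have hHb0 : 0 ≤ Hb := (abs_nonneg _).trans (hhb (Classical.choice ‹Nonempty E›))
  have hGK := integral_sq_sub_sq_kop_eq_greenKubo_of_nHit (κ := R) (π := P)
    (fun z B hB => minorised_setwise hminR z hB) (pos_iff_ne_zero.2 hm0) hε1 Nat.one_pos hπ hgbm
    hgbb hgb0 hhm hhb hpois
  -- rewrite the goal's right-hand side in the martingale form
  have hrhs : (∫ ω, (g ω - θ) ^ 2 ∂P)
        + 2 * ∑' k, ∫ ω, (g ω - θ) * (Scoring.kop R)^[k + 1] (fun ω => g ω - θ) ω ∂P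
      = ∫ x, hh x ^ 2 ∂P - ∫ x, (Scoring.kop R hh x) ^ 2 ∂P := by
    rw [hGK]
    simp only [Scoring.autocov, hgb, sq]
  rw [hrhs]
  -- the structure of the restart kernel: `Rh = u ∘ s`
  set u : Ω → ℝ := fun x => ∫ ω, hh ω ∂((κF ∘ₖ K) x) with hu
  have hum : Measurable u := (hhm.stronglyMeasurable.integral_kernel (κ := κF ∘ₖ K)).measurable
  have hub : ∀ x, |u x| ≤ Hb := fun x => by
    rw [hu, ← Real.norm_eq_abs]
    calc ‖∫ ω, hh ω ∂((κF ∘ₖ K) x)‖ ≤ Hb * ((κF ∘ₖ K) x).real univ :=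
          norm_integral_le_of_norm_le_const (Eventually.of_forall fun ω => by
            rw [Real.norm_eq_abs]; exact hhb ω)
      _ = Hb := by rw [probReal_univ, mul_one]
  have hkop : ∀ ω, Scoring.kop R hh ω = u (s ω) := fun ω => by
    simp only [Scoring.kop, hR, Kernel.comap_apply, hu]
  -- `φ = κF ḡ` and `ψ = φ + u`
  set φ : Ω → ℝ := fun x => ∫ ω, gb ω ∂(κF x) with hφ
  have hφm : Measurable φ := (hgbm.stronglyMeasurable.integral_kernel (κ := κF)).measurable
  have hφb : ∀ x, |φ x| ≤ 2 * C := fun x => by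
    rw [hφ, ← Real.norm_eq_abs]
    calc ‖∫ ω, gb ω ∂(κF x)‖ ≤ 2 * C * (κF x).real univ :=
          norm_integral_le_of_norm_le_const (Eventually.of_forall fun ω => by
            rw [Real.norm_eq_abs]; exact hgbb ω)
      _ = 2 * C := by rw [probReal_univ, mul_one]
  -- integrability bookkeeping on the fibres `κF(x, ·)`
  have hi_gb : ∀ x, Integrable gb (κF x) := fun x => Scoring.integrable_of_bounded _ hgbm hgbb
  have hi_gb2 : ∀ x, Integrable (fun ω => gb ω ^ 2) (κF x) := fun x =>
    Scoring.integrable_of_bounded _ (hgbm.pow_const 2) (C := (2 * C) ^ 2) fun ω => by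
      rw [abs_pow]; exact pow_le_pow_left₀ (abs_nonneg _) (hgbb ω) 2
  have hi_hh : ∀ (μ : Measure E) [IsProbabilityMeasure μ], Integrable hh μ := fun μ _ =>
    Scoring.integrable_of_bounded _ hhm hhb
  -- (1) `h = ḡ + u ∘ s`, hence fibrewise `∫ h dκF(x) = φ x + u x`
  have hdec : ∀ ω, hh ω = gb ω + u (s ω) := fun ω => by
    have := hpois ω
    rw [hkop ω] at this
    linarith
  have hx_h : ∀ x, ∫ ω, hh ω ∂(κF x) = φ x + u x := fun x => by
    have h1 : ∫ ω, hh ω ∂(κF x) = ∫ ω, (gb ω + u (s ω)) ∂(κF x) :=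
      integral_congr_ae (Eventually.of_forall fun ω => hdec ω)
    rw [h1, h.integral_start_eq (fun ω y => gb ω + u y) x, integral_add (hi_gb x) (integrable_const _),
      integral_const, probReal_univ, one_smul]
  -- (2) fibrewise second moment: `∫ h² dκF(x) = ∫ ḡ² dκF(x) + 2 u(x) φ(x) + u(x)²`
  have hx_h2 : ∀ x, ∫ ω, hh ω ^ 2 ∂(κF x) = ∫ ω, gb ω ^ 2 ∂(κF x) + 2 * u x * φ x + u x ^ 2 :=
    fun x => by
    have h1 : ∫ ω, hh ω ^ 2 ∂(κF x) = ∫ ω, (gb ω + u (s ω)) ^ 2 ∂(κF x) :=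
      integral_congr_ae (Eventually.of_forall fun ω => by
        show hh ω ^ 2 = (gb ω + u (s ω)) ^ 2
        rw [hdec ω])
    rw [h1, h.integral_start_eq (fun ω y => (gb ω + u y) ^ 2) x,
      show φ x = ∫ ω, gb ω ∂(κF x) from rfl]
    have hexp : (fun ω => (gb ω + u x) ^ 2) = fun ω => gb ω ^ 2 + (2 * u x) * gb ω + u x ^ 2 := by
      funext ω; ring
    have i1 : Integrable (fun ω => gb ω ^ 2) (κF x) := hi_gb2 x
    have i2 : Integrable (fun ω => (2 * u x) * gb ω) (κF x) := (hi_gb x).const_mul _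
    have i3 : Integrable (fun _ : E => u x ^ 2) (κF x) := integrable_const _
    have i12 : Integrable (fun ω => gb ω ^ 2 + (2 * u x) * gb ω) (κF x) := i1.add i2
    rw [hexp, integral_add i12 i3, integral_add i1 i2, integral_const_mul, integral_const,
      probReal_univ, one_smul]
  -- (3) fibrewise: `∫ (Rh)² dκF(x) = u(x)²`
  have hx_k2 : ∀ x, ∫ ω, (Scoring.kop R hh ω) ^ 2 ∂(κF x) = u x ^ 2 := fun x => by
    have h1 : ∫ ω, (Scoring.kop R hh ω) ^ 2 ∂(κF x) = ∫ ω, u (s ω) ^ 2 ∂(κF x) :=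
      integral_congr_ae (Eventually.of_forall fun ω => by
        show (Scoring.kop R hh ω) ^ 2 = u (s ω) ^ 2
        rw [hkop ω])
    rw [h1, h.integral_start_eq (fun _ y => u y ^ 2) x, integral_const, probReal_univ, one_smul]
  -- (4) fibrewise conditional variance of `g`: `∫ (g − ∫ g dκF(x))² dκF(x) = ∫ ḡ² dκF(x) − φ(x)²`
  have hx_var : ∀ x, ∫ ω, (g ω - ∫ ω', g ω' ∂(κF x)) ^ 2 ∂(κF x)
      = ∫ ω, gb ω ^ 2 ∂(κF x) - φ x ^ 2 := fun x => by
    have hmean : ∫ ω', g ω' ∂(κF x) = φ x + θ := by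
      simp only [hφ, hgb]
      rw [integral_sub (Scoring.integrable_of_bounded _ hg hC) (integrable_const _), integral_const,
        probReal_univ, one_smul]
      ring
    have hexp : (fun ω => (g ω - ∫ ω', g ω' ∂(κF x)) ^ 2)
        = fun ω => gb ω ^ 2 - (2 * φ x) * gb ω + φ x ^ 2 := by
      funext ω; rw [hmean]; simp only [hgb]; ring
    have i1 : Integrable (fun ω => gb ω ^ 2) (κF x) := hi_gb2 x
    have i2 : Integrable (fun ω => (2 * φ x) * gb ω) (κF x) := (hi_gb x).const_mul _
    have i3 : Integrable (fun _ : E => φ x ^ 2) (κF x) := integrable_const _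
    have i12 : Integrable (fun ω => gb ω ^ 2 - (2 * φ x) * gb ω) (κF x) := i1.sub i2
    rw [hexp, integral_add i12 i3, integral_sub i1 i2, integral_const_mul, integral_const,
      probReal_univ, one_smul, show ∫ ω, gb ω ∂(κF x) = φ x from rfl]
    ring
  -- (5) `u = K ψ` with `ψ = φ + u`
  have hx_u : ∀ x, u x = Scoring.kop K (fun y => φ y + u y) x := fun x => by
    have h1 : u x = ∫ y, ∫ ω, hh ω ∂(κF y) ∂(K x) := by
      simp only [hu]
      exact Kernel.integral_comp (hi_hh ((κF ∘ₖ K) x))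
    rw [h1]
    simp only [Scoring.kop]
    exact integral_congr_ae (Eventually.of_forall fun y => hx_h y)
  -- integrate over the prior: the three global identities
  have hP_h2 : ∫ ω, hh ω ^ 2 ∂P = ∫ x, (∫ ω, gb ω ^ 2 ∂(κF x) + 2 * u x * φ x + u x ^ 2) ∂nb := by
    rw [hPdef, integral_fwdPathLaw_eq_integral_integral ν₀ κF (hhm.pow_const 2) (C := Hb ^ 2)
      (fun ω => by rw [abs_pow]; exact pow_le_pow_left₀ (abs_nonneg _) (hhb ω) 2)]
    exact integral_congr_ae (Eventually.of_forall fun x => hx_h2 x)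
  have hP_k2 : ∫ ω, (Scoring.kop R hh ω) ^ 2 ∂P = ∫ x, u x ^ 2 ∂nb := by
    have hkm : Measurable (Scoring.kop R hh) := Scoring.measurable_kop R hhm
    have hkb : ∀ ω, |Scoring.kop R hh ω| ≤ Hb := Scoring.abs_kop_le R hhb
    rw [hPdef, integral_fwdPathLaw_eq_integral_integral ν₀ κF (hkm.pow_const 2) (C := Hb ^ 2)
      (fun ω => by rw [abs_pow]; exact pow_le_pow_left₀ (abs_nonneg _) (hkb ω) 2)]
    exact integral_congr_ae (Eventually.of_forall fun x => hx_k2 x)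
  have hV : ∫ x, ∫ ω, (g ω - ∫ ω', g ω' ∂(κF x)) ^ 2 ∂(κF x) ∂nb
      = ∫ x, (∫ ω, gb ω ^ 2 ∂(κF x) - φ x ^ 2) ∂nb :=
    integral_congr_ae (Eventually.of_forall fun x => hx_var x)
  -- integrability over the prior
  have hVm : Measurable fun x => ∫ ω, gb ω ^ 2 ∂(κF x) :=
    ((hgbm.pow_const 2).stronglyMeasurable.integral_kernel (κ := κF)).measurable
  have hVb : ∀ x, |∫ ω, gb ω ^ 2 ∂(κF x)| ≤ (2 * C) ^ 2 := fun x => by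
    rw [← Real.norm_eq_abs]
    calc ‖∫ ω, gb ω ^ 2 ∂(κF x)‖ ≤ (2 * C) ^ 2 * (κF x).real univ :=
          norm_integral_le_of_norm_le_const (Eventually.of_forall fun ω => by
            rw [Real.norm_eq_abs, abs_pow]; exact pow_le_pow_left₀ (abs_nonneg _) (hgbb ω) 2)
      _ = (2 * C) ^ 2 := by rw [probReal_univ, mul_one]
  have hiV : Integrable (fun x => ∫ ω, gb ω ^ 2 ∂(κF x)) nb := Scoring.integrable_of_bounded _ hVm hVb
  have hiuφ : Integrable (fun x => 2 * u x * φ x) nb :=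
    Scoring.integrable_of_bounded _ ((hum.const_mul 2).mul hφm) (C := 2 * Hb * (2 * C)) fun x => by
      rw [abs_mul, abs_mul, abs_of_pos (by norm_num : (0 : ℝ) < 2)]
      exact mul_le_mul (mul_le_mul_of_nonneg_left (hub x) (by norm_num)) (hφb x) (abs_nonneg _)
        (by positivity)
  have hiu2 : Integrable (fun x => u x ^ 2) nb :=
    Scoring.integrable_of_bounded _ (hum.pow_const 2) (C := Hb ^ 2) fun x => by
      rw [abs_pow]; exact pow_le_pow_left₀ (abs_nonneg _) (hub x) 2
  have hiφ2 : Integrable (fun x => φ x ^ 2) nb :=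
    Scoring.integrable_of_bounded _ (hφm.pow_const 2) (C := (2 * C) ^ 2) fun x => by
      rw [abs_pow]; exact pow_le_pow_left₀ (abs_nonneg _) (hφb x) 2
  -- Jensen + invariance: `∫ (Kψ)² dν̄₀ ≤ ∫ ψ² dν̄₀`
  have hψm : Measurable fun y => φ y + u y := hφm.add hum
  have hψb : ∀ y, |φ y + u y| ≤ 2 * C + Hb := fun y =>
    (abs_add_le _ _).trans (add_le_add (hφb y) (hub y))
  have hJ := sq_sub_sq_kop_nonneg (κ := K) (π := nb) hKnb hψm hψb
  have hKψ : ∫ x, (Scoring.kop K (fun y => φ y + u y) x) ^ 2 ∂nb = ∫ x, u x ^ 2 ∂nb :=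
    integral_congr_ae (Eventually.of_forall fun x => by
      show (Scoring.kop K (fun y => φ y + u y) x) ^ 2 = u x ^ 2
      rw [← hx_u x])
  rw [hKψ] at hJ
  have hψ2 : ∫ x, (φ x + u x) ^ 2 ∂nb = ∫ x, φ x ^ 2 ∂nb + ∫ x, 2 * u x * φ x ∂nb + ∫ x, u x ^ 2 ∂nb := by
    have hexp : (fun x => (φ x + u x) ^ 2) = fun x => φ x ^ 2 + 2 * u x * φ x + u x ^ 2 := by
      funext x; ring
    have iA : Integrable (fun x => φ x ^ 2 + 2 * u x * φ x) nb := hiφ2.add hiuφ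
    rw [hexp, integral_add iA hiu2, integral_add hiφ2 hiuφ]
  -- assemble
  have iB : Integrable (fun x => ∫ ω, gb ω ^ 2 ∂(κF x) + 2 * u x * φ x) nb := hiV.add hiuφ
  rw [hV, hP_h2, hP_k2, integral_sub hiV hiφ2, integral_add iB hiu2, integral_add hiV hiuφ]
  linarith [hJ, hψ2]

/-! ## §3 Positivity of the asymptotic variance from conditional variance -/

omit [IsFiniteMeasure ν₁] [IsMarkovKernel κR] in
/-- **`σ²_g > 0` WHENEVER THE OBSERVABLE IS NOT DETERMINED BY THE LAUNCH POINT**: if the mean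
conditional variance `∫ Var_{κF(x,·)}(g) d(Z₀⁻¹ν₀)` is positive then the Green–Kubo variance of `g`
along the restart chain is positive — in row 8's `autocov` form, the hypothesis `hσ` of the
studentized / Γ-method coverage theorems (`NCMCGeneralSpaceGammaMethodStudentizedCLT`,
`NCMCGeneralSpaceRestartChainGammaCoverage`). -/
theorem greenKubo_variance_restartChain_pos_of_condVar (K : Kernel Ω Ω) [IsMarkovKernel K]
    (h0 : ν₀ univ ≠ 0) (hK : Kernel.Invariant K ν₀) (h : CrooksPair ν₀ ν₁ κF κR s e W)
    {m : Measure Ω} [IsFiniteMeasure m] (hm0 : m univ ≠ 0) (hmin : ∀ z, m ≤ K z)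
    {g : E → ℝ} (hg : Measurable g) {C : ℝ} (hC : ∀ ω, |g ω| ≤ C)
    (hV : 0 < ∫ x, ∫ ω, (g ω - ∫ ω', g ω' ∂(κF x)) ^ 2 ∂(κF x) ∂((ν₀ univ)⁻¹ • ν₀)) :
    0 < Scoring.autocov ((κF ∘ₖ K).comap s h.measurable_s) (fwdPathLaw ν₀ κF)
          (fun ω => g ω - ∫ z, g z ∂(fwdPathLaw ν₀ κF)) 0
        + 2 * ∑' t, Scoring.autocov ((κF ∘ₖ K).comap s h.measurable_s) (fwdPathLaw ν₀ κF)
          (fun ω => g ω - ∫ z, g z ∂(fwdPathLaw ν₀ κF)) (t + 1) := by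
  rw [← cltVariance_eq_autocov]
  exact hV.trans_le (h.integral_condVar_le_greenKubo_variance_restartChain K h0 hK hm0 hmin hg hC)

omit [IsFiniteMeasure ν₁] in
/-- **THE JARZYNSKI LANE: `σ²_w > 0` WHENEVER THE WORK IS NOT DETERMINED BY THE LAUNCH
CONFIGURATION.**  With bounded-below work `−B ≤ W`: if
`∫ Var_{κF(x,·)}(e^{−W}) d(Z₀⁻¹ν₀) > 0` then the Green–Kubo variance of the weights along the
restart chain — centred at `Z₁/Z₀` — is positive (the hypothesis `hσ` of
`CrooksPair.tendsto_measure_jarzynskiEstimate_mem_gammaInterval_restartChain`). -/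
theorem greenKubo_variance_exp_neg_work_restartChain_pos_of_condVar (K : Kernel Ω Ω)
    [IsMarkovKernel K] (h0 : ν₀ univ ≠ 0) (hK : Kernel.Invariant K ν₀)
    (h : CrooksPair ν₀ ν₁ κF κR s e W) {m : Measure Ω} [IsFiniteMeasure m] (hm0 : m univ ≠ 0)
    (hmin : ∀ z, m ≤ K z) {B : ℝ} (hB : ∀ ω, -B ≤ W ω)
    (hV : 0 < ∫ x, ∫ ω, (Real.exp (-W ω) - ∫ ω', Real.exp (-W ω') ∂(κF x)) ^ 2 ∂(κF x)
      ∂((ν₀ univ)⁻¹ • ν₀)) :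
    0 < Scoring.autocov ((κF ∘ₖ K).comap s h.measurable_s) (fwdPathLaw ν₀ κF)
          (fun ω => Real.exp (-W ω) - ((ν₀ univ)⁻¹ * ν₁ univ).toReal) 0
        + 2 * ∑' t, Scoring.autocov ((κF ∘ₖ K).comap s h.measurable_s) (fwdPathLaw ν₀ κF)
          (fun ω => Real.exp (-W ω) - ((ν₀ univ)⁻¹ * ν₁ univ).toReal) (t + 1) := by
  have hC : ∀ ω, |Real.exp (-W ω)| ≤ Real.exp B := fun ω => by
    rw [abs_of_pos (Real.exp_pos _)]
    exact Real.exp_le_exp.2 (by linarith [hB ω])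
  have key := h.greenKubo_variance_restartChain_pos_of_condVar K h0 hK hm0 hmin
    (g := fun ω => Real.exp (-W ω)) (Real.measurable_exp.comp h.measurable_W.neg) hC hV
  rwa [h.integral_exp_neg_work] at key

end CrooksPair

end Summit.Ventures.LatticeQCDFlow.Exactness.GeneralNCMC

/-! ## §4 (GEN-22 append) The criterion by a SET of launch points: `ν₀{x | Var_{κF(x,·)}(g) ≠ 0} ≠ 0 ⇒ σ²_g > 0`
(the integral hypothesis of §3 restated as "the work is non-degenerate on a set of launch points of
positive prior weight", the form a protocol designer checks). -/

namespace Summit.Ventures.LatticeQCDFlow.Exactness.GeneralNCMC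
namespace CrooksPair
open MeasureTheory ProbabilityTheory Set
open scoped ENNReal
variable {Ω E : Type*} [MeasurableSpace Ω] [MeasurableSpace E] {ν₀ ν₁ : Measure Ω}
  [IsFiniteMeasure ν₀] {κF κR : Kernel Ω E} [IsMarkovKernel κF] {s e : E → Ω} {W : E → ℝ}

/-- **`σ²_g > 0` as soon as the conditional variance is non-zero on a set of launch points of positive
prior weight.** -/
theorem greenKubo_variance_restartChain_pos_of_condVar_ne_zero (K : Kernel Ω Ω) [IsMarkovKernel K]
    (h0 : ν₀ univ ≠ 0) (hK : Kernel.Invariant K ν₀) (h : CrooksPair ν₀ ν₁ κF κR s e W)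
    {m : Measure Ω} [IsFiniteMeasure m] (hm0 : m univ ≠ 0) (hmin : ∀ z, m ≤ K z)
    {g : E → ℝ} (hg : Measurable g) {C : ℝ} (hC : ∀ ω, |g ω| ≤ C)
    (hV : ν₀ {x | ∫ ω, (g ω - ∫ ω', g ω' ∂(κF x)) ^ 2 ∂(κF x) ≠ 0} ≠ 0) :
    0 < Scoring.autocov ((κF ∘ₖ K).comap s h.measurable_s) (fwdPathLaw ν₀ κF)
          (fun ω => g ω - ∫ z, g z ∂(fwdPathLaw ν₀ κF)) 0
        + 2 * ∑' t, Scoring.autocov ((κF ∘ₖ K).comap s h.measurable_s) (fwdPathLaw ν₀ κF)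
          (fun ω => g ω - ∫ z, g z ∂(fwdPathLaw ν₀ κF)) (t + 1) := by
  refine h.greenKubo_variance_restartChain_pos_of_condVar K h0 hK hm0 hmin hg hC ?_
  -- the fibrewise variance `V` is measurable, non-negative and bounded
  have hprod : Measurable fun p : Ω × E => (g p.2 - ∫ ω', g ω' ∂(κF p.1)) ^ 2 :=
    ((hg.comp measurable_snd).sub ((hg.stronglyMeasurable.integral_kernel (κ := κF)).measurable.comp
      measurable_fst)).pow_const 2
  have hVm : Measurable fun x => ∫ ω, (g ω - ∫ ω', g ω' ∂(κF x)) ^ 2 ∂(κF x) :=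
    (hprod.stronglyMeasurable.integral_kernel_prod_right' (κ := κF)).measurable
  have hV0 : ∀ x, 0 ≤ ∫ ω, (g ω - ∫ ω', g ω' ∂(κF x)) ^ 2 ∂(κF x) :=
    fun x => integral_nonneg fun ω => sq_nonneg _
  have hVb : ∀ x, |∫ ω, (g ω - ∫ ω', g ω' ∂(κF x)) ^ 2 ∂(κF x)| ≤ (C + C) ^ 2 := fun x => by
    rw [← Real.norm_eq_abs]
    have hmx : |∫ ω', g ω' ∂(κF x)| ≤ C := by
      rw [← Real.norm_eq_abs]
      calc ‖∫ ω', g ω' ∂(κF x)‖ ≤ C * (κF x).real univ := norm_integral_le_of_norm_le_const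
              (Filter.Eventually.of_forall fun ω => by rw [Real.norm_eq_abs]; exact hC ω)
        _ = C := by rw [probReal_univ, mul_one]
    calc ‖∫ ω, (g ω - ∫ ω', g ω' ∂(κF x)) ^ 2 ∂(κF x)‖ ≤ (C + C) ^ 2 * (κF x).real univ :=
          norm_integral_le_of_norm_le_const (Filter.Eventually.of_forall fun ω => by
            rw [Real.norm_eq_abs, abs_pow]
            exact pow_le_pow_left₀ (abs_nonneg _)
              ((abs_sub _ _).trans (add_le_add (hC ω) hmx)) 2)
      _ = (C + C) ^ 2 := by rw [probReal_univ, mul_one]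
  have hint : Integrable (fun x => ∫ ω, (g ω - ∫ ω', g ω' ∂(κF x)) ^ 2 ∂(κF x)) ((ν₀ univ)⁻¹ • ν₀) :=
    Scoring.integrable_of_bounded _ hVm hVb
  rw [integral_pos_iff_support_of_nonneg hV0 hint, Measure.smul_apply, smul_eq_mul]
  refine ENNReal.mul_pos (ENNReal.inv_ne_zero.2 (measure_ne_top _ _)) ?_
  exact hV

end CrooksPair
end Summit.Ventures.LatticeQCDFlow.Exactness.GeneralNCMC
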